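import Literature.Probability.Percolation.SlabCircuitSideCrossings
import HarnessLib

/-!
# Newman–Tassion–Wu 2017, Theorem 3.10 — the gluing datum of the top-right corner

Topic: `Literature/Probability/Percolation`. Part of the port of THEOREM 3.10 of Newman–Tassion–Wu,
*Critical percolation and the minimal spanning tree in slabs* (CPAM 70 (2017); arXiv:1512.09107,
pp. 12–14). The gluing datum (`GlueData`, `SlabRSWGluingCore.lean`) of the top-right corner of the
port's square ring (`SlabCircuitFromCornerLinks.lean`):
`Q₁ = (S := domT, R := domT ∪ corR, A := {x = -N}, B := {x = N+n+1}, C := {y = -N})`, so that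
`Q₁.evAB ∩ {corR crossed} = cornerDom₁` and `Q₁.evCA = cornerLink₁` (`cornerQ₁`, `cornerQ₁_evCA`,
`cornerQ₁_evAB_inter`). The surgery for it is constructed in `SlabCircuitCornerSurgery.lean`.

## Sources

* C. M. Newman, V. Tassion, W. Wu, *Critical percolation and the minimal spanning tree in slabs*,
  Comm. Pure Appl. Math. 70 (2017), arXiv:1512.09107: proof of Theorem 3.10, (3.121)–(3.122)
  [NewmanTassionWu2017].
-/

noncomputable section

namespace Literature.Probability.Percolation

open MeasureTheory LatticeModels SimpleGraph

namespace NTW17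

variable {k : ℕ}

/-! ## The gluing datum of the top-right corner -/

section Datum

variable (N n : ℕ)

/-- **`Q₁`**: minimal path in `domT` from the hole's left edge `{x = -N}` to the outer column
`{x = N+n+1}`, glued connection inside `domT ∪ corR` from the corridor's bottom row `{y = -N}`.
[cite: NewmanTassionWu2017, Theorem 3.10 (proof, (3.121)–(3.122))] -/
def cornerQ₁ : GlueData where
  S := domT N n
  R := domT N n ∪ corR N n
  A := {z | z.1 = -(N : ℤ)}
  B := {z | z.1 = (N : ℤ) + n + 1}
  C := {z | z.2 = -(N : ℤ)}
  hSR := Set.subset_union_left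
  hSfin := boxR_finite _ _ _ _
  hRfin := (boxR_finite _ _ _ _).union (boxR_finite _ _ _ _)

/-- `Q₁.evCA = cornerLink₁`. [cite: NewmanTassionWu2017, Theorem 3.10 (proof, (3.121)–(3.122))] -/
theorem cornerQ₁_evCA : (cornerQ₁ N n).evCA k = cornerLink₁ k N n := rfl

/-- `Q₁.evAB ∩ {corR crossed} = cornerDom₁`. [cite: NewmanTassionWu2017, Theorem 3.10 (proof, (3.121)–(3.122))] -/
theorem cornerQ₁_evAB_inter :
    (cornerQ₁ N n).evAB k ∩ slabConn k (corR N n) {z | z.2 = -(N : ℤ)} {z | z.2 = (N : ℤ) + n} =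
      cornerDom₁ k N n := rfl

end Datum

end NTW17

end Literature.Probability.Percolation

end
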